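import Summits.CriticalPhenomena.PercolationContinuityZ3.Theses.PercFiniteBoxLRO
import Literature.Probability.Percolation.Percolation
import Literature.Probability.Percolation.CriticalContinuity

/-!
# Route `PercFiniteBoxLRO`, item `Assembly` (stmt-CriticalPhenomena-0856)

`Assembly` says `X_D → R → PercolationContinuityZ3`, where

* `X_D` (= `LinearScaleLROOfTheta`): for every `p` with `θ(p) > 0` there are `ρ > 0` and `K` with
  `P_p(x ↔ y inside Λ(Kn)) ≥ ρ` for all `n ≥ 1`, `x, y ∈ Λ(n)` (finite-box long-range order at
  linear scale, Cerf 2015, arXiv:1306.3105, p. 5);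
* `R` (= `RenormaliseFromLinearLRO`): linear-scale long-range order at `p` gives percolation at
  some `p' < p`.

Proof (six lines, as in the route's deciding theorem `closes`): `PercolationContinuityZ3` is
`θ_{ℤ³}(p_c) = 0`. If not, `θ(p_c) > 0` since `θ` is a probability; `X_D` at `p_c = criticalProbI 3`
gives linear-scale long-range order at `p_c`; `R` gives `p' < p_c` with `θ(p') > 0`; but
`(p' : ℝ) < p_c = criticalProb (zdGraph 3) 0`, so `θ(p') = 0` by the definition of `p_c`
(`Literature.Probability.Percolation.theta_eq_zero_of_lt_criticalProb_holds`, proved in the tree).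
Contradiction. No percolation estimate is used: the content of the route lives in `X_D` and `R`.
-/

namespace Summit.CriticalPhenomena.PercolationContinuityZ3.Theorems

open MeasureTheory Literature.Probability.Percolation Literature.Probability.LatticeModels

/-- **Item `stmt-CriticalPhenomena-0856` (`PercFiniteBoxLRO.Assembly`), proved.**
`X_D → R → PercolationContinuityZ3`: if `θ(p_c) ≠ 0` then `θ(p_c) > 0`; linear-scale finite-box
long-range order at `p_c` (from `X_D`) renormalises (by `R`) to `θ(p') > 0` at some `p' < p_c`,
contradicting `θ ≡ 0` below `p_c` (`theta_eq_zero_of_lt_criticalProb_holds`, Grimmett 1999 §1.4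
(1.11)). Hence `θ_{ℤ³}(p_c) = 0`. [folklore] -/
theorem percFiniteBoxLRO_assembly_proof :
    Summit.CriticalPhenomena.PercolationContinuityZ3.Theses.PercFiniteBoxLRO.Assembly := by
  unfold Summit.CriticalPhenomena.PercolationContinuityZ3.Theses.PercFiniteBoxLRO.Assembly
  intro hX hR
  -- `PercolationContinuityZ3` is `θ (zdGraph 3) 0 (p_c) = 0`; argue by contradiction.
  show theta (zdGraph 3) (0 : Site 3) (criticalProbI 3) = 0
  by_contra hne
  have hpos : 0 < theta (zdGraph 3) (0 : Site 3) (criticalProbI 3) :=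
    lt_of_le_of_ne measureReal_nonneg (Ne.symm hne)
  -- `X_D` at `p_c`, then `R`: percolation strictly below `p_c`
  obtain ⟨p', hp'lt, hp'pos⟩ := hR (criticalProbI 3) (hX (criticalProbI 3) hpos)
  have hlt : ((p' : unitInterval) : ℝ) < criticalProb (zdGraph 3) (0 : Site 3) := hp'lt
  -- but `θ ≡ 0` below `p_c`
  have h0 : theta (zdGraph 3) (0 : Site 3) p' = 0 :=
    theta_eq_zero_of_lt_criticalProb_holds (zdGraph 3) (0 : Site 3) p' hlt
  exact absurd h0 (ne_of_gt hp'pos)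

end Summit.CriticalPhenomena.PercolationContinuityZ3.Theorems
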